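import Literature.AlgebraicGeometry.Resolution.Principalization
import Literature.AlgebraicGeometry.Resolution.RegularBlowup
import Literature.AlgebraicGeometry.Resolution.RegularCentreBlowupSeqIntegral
import Literature.AlgebraicGeometry.Resolution.NonPrincipalLocus
import Literature.AlgebraicGeometry.Resolution.BlowupsComposition
import HarnessLib

/-!
# Crux `PatchingRel` (stmt-ResolutionOfSingularities-0642), line `sandwiched-gluing` (v3 cut),
# stub `stub_formatPrincipalization_dim3_of_cossartPiltant`

**Principalization in blow-up format is known in dimension three, modulo Cossart–Piltant's
Prop. 4.4.** Cossart–Piltant (J. Algebra 529 (2019), Prop. 4.4 = arXiv v1 Prop. 4.3; vendored as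
the named fact `CossartPiltant2019Principalization`, `Principalization.lean`) principalize a
non-zero ideal sheaf `𝓘` on a regular excellent Noetherian integral threefold `𝒮` by a finite
SEQUENCE `𝒮 = 𝒮(0) ← 𝒮(1) ← ⋯ ← 𝒮(r)` of blowing ups along regular integral centres
`𝒴(j) ⊆ {s ∈ 𝒮(j) : 𝓘𝒪_{𝒮(j),s}` is not locally principal`}`. The line's Axiom 4 in blow-up
format (`PrincipalizationInChar`) asks instead for ONE blowing up `σ : U₁ → U` of `U` along an
ideal sheaf `Q` cosupported in `V(𝓘)`, with `U₁` regular and `𝓘𝒪_{U₁}` an effective Cartier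
divisor. This file PROVES that the sequence format yields the blow-up format:

* `IsRegularCentreBlowupSeq.exists_isBlowup_supported` — a Cossart–Piltant sequence
  `σ : S' → S` for `J` over a Noetherian `S` is a blowing up of `S` along an ideal sheaf `Q` with
  `Supp Q ⊆ V(J)`: each centre `𝒴(j)` lies in the non-locally-principal locus of `J𝒪_{𝒮(j)}`,
  hence in `V(J𝒪_{𝒮(j)}) = σ_j⁻¹ V(J)` (`isLocallyPrincipalAt_of_not_mem_support`), and
  compositions of `V(J)`-supported blowing ups of a Noetherian scheme are `V(J)`-supported
  blowing ups (Raynaud; Temkin 2008, Lemma 2.1.4; Stacks 080B: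
  `IsBlowup.exists_isBlowup_comp_supported`, `BlowupsComposition.lean`);
* `isEffectiveCartier_of_isLocallyPrincipal_of_ne_bot` — on an integral scheme a non-zero
  locally principal ideal sheaf is an effective Cartier divisor (a local generator on an affine
  open `U ∋ x` is non-zero, since `J(U) = 0` would put the generic point in `V(J)`, and `Γ(X, U)`
  is a domain);
* `formatPrincipalization_dim3_of_cossartPiltant` (universe-polymorphic) and the registered
  universe-`0` stub `stub_formatPrincipalization_dim3_of_cossartPiltant` — assembling these with
  `IsRegularCentreBlowupSeq.isRegular` (`RegularBlowup.lean`: blowing ups of regular schemes in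
  regular centres are regular) and `IsRegularCentreBlowupSeq.isIntegral_and_comap_ne_bot`
  (`RegularCentreBlowupSeqIntegral.lean`).

## References

* V. Cossart, O. Piltant, *Resolution of singularities of arithmetical threefolds*, J. Algebra
  529 (2019) 268–535, Prop. 4.4 (arXiv:1412.0868 v1: Prop. 4.3). [CossartPiltant2019]
* M. Temkin, *Desingularization of quasi-excellent schemes in characteristic zero*, Adv. Math.
  219 (2008) 488–522, §2.1, Lemma 2.1.4. [Temkin2008]
* The Stacks Project, Tags 080B (composition of blowing ups), 01WS (effective Cartier
  divisors). [StacksProject]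
-/

-- `Summit.<Summit>.<Sub>.Theorems` with `Sub = Summit` (single-conjunct summit, D-0017): the
-- duplicated namespace component is the tree layout.
set_option linter.dupNamespace false

noncomputable section

namespace Summit.ResolutionOfSingularities.ResolutionOfSingularities.Theorems

open CategoryTheory AlgebraicGeometry
open Literature.AlgebraicGeometry.Resolution

universe u

/-! ## A Cossart–Piltant sequence is one `V(J)`-supported blowing up -/

/-- **A sequence of blowing ups along regular centres in the non-locally-principal loci of the
transforms of `J` is ONE blowing up along an ideal sheaf cosupported in `V(J)`** (over a
Noetherian base). Induction on the sequence: the empty sequence is the blowing up along `⊤`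
(support `∅`); if `σ : S' → S` is the blowing up along `Q` with `Supp Q ⊆ V(J)` and
`τ : S'' → S'` is the blowing up along the reduced centre `Y ⊆ S'`, all of whose points are
non-locally-principal points of `J𝒪_{S'}`, then `Y ⊆ V(J𝒪_{S'}) = σ⁻¹ V(J)` (off its support an
ideal sheaf is locally the unit ideal), so `τ ≫ σ` is a `V(J)`-supported blowing up by Temkin's
Lemma 2.1.4 (Raynaud; Stacks 080B) in its Noetherian two-step form
`IsBlowup.exists_isBlowup_comp_supported`. [cite: Temkin2008, Lemma 2.1.4] -/
theorem IsRegularCentreBlowupSeq.exists_isBlowup_supported :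
    ∀ {S' S : Scheme.{u}} {σ : S' ⟶ S} {J : S.IdealSheafData}, IsRegularCentreBlowupSeq σ J →
      IsNoetherian S →
      ∃ Q : S.IdealSheafData, IsBlowup σ Q ∧ (Q.support : Set S) ⊆ J.support := by
  intro S' S σ J h
  induction h with
  | nil J =>
    intro _
    exact ⟨⊤, isBlowup_id_top _, by simp⟩
  | @cons S'' S' S τ σ J Y hσ hYint hYreg hY hτ ih =>
    intro hN
    haveI := hN
    obtain ⟨Q, hQ, hQJ⟩ := ih hN
    refine IsBlowup.exists_isBlowup_comp_supported σ Q τ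
      (Scheme.IdealSheafData.vanishingIdeal Y) (J.support : Set S) hQ hQJ hτ ?_
    -- the centre lies in `V(J𝒪_{S'}) = σ⁻¹ V(J)`
    intro y hy
    rw [Scheme.IdealSheafData.coe_support_vanishingIdeal] at hy
    have hy' : y ∈ (J.comap σ).support :=
      not_imp_comm.mp isLocallyPrincipalAt_of_not_mem_support (hY y hy)
    rw [Scheme.IdealSheafData.support_comap] at hy'
    exact hy'

/-! ## Non-zero locally principal ideal sheaves on integral schemes are effective Cartier -/

/-- **On an integral scheme, a non-zero locally principal ideal sheaf is an effective Cartier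
divisor**: if `J(U) = (f)` on an affine open `U ∋ x`, then `f ≠ 0` — otherwise `J(U) = 0` and the
generic point, which lies in `U`, would lie in `V(J)`, forcing `J = 0` — and a non-zero element
of the domain `Γ(X, U)` is a non-zero-divisor (Stacks 01WS: a closed subscheme locally cut out by
one non-zero-divisor is an effective Cartier divisor). [cite: StacksProject, Tag 01WS] -/
theorem isEffectiveCartier_of_isLocallyPrincipal_of_ne_bot {X : Scheme.{u}} [IsIntegral X]
    (J : X.IdealSheafData) (hJ : J ≠ ⊥) (h : IsLocallyPrincipal J) : IsEffectiveCartier J := by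
  intro x
  obtain ⟨U, hxU, f, hf⟩ := h x
  refine ⟨U, hxU, f, ?_, hf⟩
  haveI : Nonempty (U : X.Opens) := ⟨⟨x, hxU⟩⟩
  refine mem_nonZeroDivisors_of_ne_zero fun hf0 => ?_
  -- `J(U) = 0`: the generic point of `X` lies in `U`, hence in `V(J)`
  apply not_mem_support_genericPoint hJ
  have hξU : genericPoint X ∈ (U : X.Opens) :=
    ((genericPoint_spec X).mem_open_set_iff U.1.isOpen).mpr ⟨x, Set.mem_univ x, hxU⟩
  rw [Scheme.IdealSheafData.mem_support_iff_of_mem (I := J) (U := U) hξU, hf, hf0,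
    Scheme.zeroLocus_span, Scheme.mem_zeroLocus_iff]
  rintro g (rfl : g = 0)
  rw [Scheme.basicOpen_zero]
  exact id

/-! ## Assembly: the blow-up format of Axiom 4 in dimension three -/

/-- **Cossart–Piltant's Prop. 4.4 in blow-up format.** Granting
`CossartPiltant2019Principalization` (Cossart–Piltant 2019, Prop. 4.4: on a regular excellent
Noetherian integral threefold `U`, every non-zero ideal sheaf `I` is principalized by a finite
sequence of blowing ups along regular integral centres in the non-locally-principal loci of its
transforms), there is ONE blowing up `σ : U₁ → U` along an ideal sheaf `Q` with
`Supp Q ⊆ V(I)` (`IsRegularCentreBlowupSeq.exists_isBlowup_supported`; Temkin 2008, Lemma 2.1.4)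
such that `U₁` is regular (`IsRegularCentreBlowupSeq.isRegular`) and `I𝒪_{U₁}` is an effective
Cartier divisor (`U₁` is integral and `I𝒪_{U₁} ≠ 0`, `IsRegularCentreBlowupSeq.isIntegral_and_comap_ne_bot`;
then `isEffectiveCartier_of_isLocallyPrincipal_of_ne_bot`).
[cite: CossartPiltant2019, Prop. 4.4 (arXiv v1: Prop. 4.3)] -/
theorem formatPrincipalization_dim3_of_cossartPiltant
    (h : Literature.AlgebraicGeometry.Resolution.CossartPiltant2019Principalization.{u})
    (U : Scheme.{u}) [IsIntegral U] [IsNoetherian U] (hreg : Scheme.IsRegular U)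
    (hexc : Scheme.IsExcellent U) (hdim : topologicalKrullDim U = 3) (I : U.IdealSheafData)
    (hI : I ≠ ⊥) :
    ∃ (Q : U.IdealSheafData) (U1 : Scheme.{u}) (σ : U1 ⟶ U), (Q.support : Set U) ⊆ I.support ∧
      IsBlowup σ Q ∧ Scheme.IsRegular U1 ∧ IsEffectiveCartier (I.comap σ) := by
  obtain ⟨U1, σ, hσ, hprinc⟩ := h U hreg hexc hdim I hI
  obtain ⟨Q, hQ, hQI⟩ := IsRegularCentreBlowupSeq.exists_isBlowup_supported hσ inferInstance
  obtain ⟨hint, -, hI'⟩ := hσ.isIntegral_and_comap_ne_bot inferInstance inferInstance hI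
  haveI := hint
  exact ⟨Q, U1, σ, hQI, hQ, hσ.isRegular hreg,
    isEffectiveCartier_of_isLocallyPrincipal_of_ne_bot (I.comap σ) hI' hprinc⟩

/-- **Stub `stub_formatPrincipalization_dim3_of_cossartPiltant` of line `sandwiched-gluing`**
(crux `PatchingRel`, stmt-ResolutionOfSingularities-0642), the universe-`0` instance of
`formatPrincipalization_dim3_of_cossartPiltant`: modulo Cossart–Piltant 2019, Prop. 4.4, the
blow-up format of Axiom 4 (one `V(I)`-supported blowing up with regular source principalizing
`I`) holds on regular excellent Noetherian integral threefolds.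
[cite: CossartPiltant2019, Prop. 4.4 (arXiv v1: Prop. 4.3)] -/
theorem stub_formatPrincipalization_dim3_of_cossartPiltant :
    Literature.AlgebraicGeometry.Resolution.CossartPiltant2019Principalization.{0} →
      ∀ (U : Scheme.{0}) [IsIntegral U] [IsNoetherian U], Scheme.IsRegular U →
        Scheme.IsExcellent U → topologicalKrullDim U = 3 → ∀ I : U.IdealSheafData, I ≠ ⊥ →
          ∃ (Q : U.IdealSheafData) (U1 : Scheme.{0}) (σ : U1 ⟶ U),
            (Q.support : Set U) ⊆ I.support ∧ IsBlowup σ Q ∧ Scheme.IsRegular U1 ∧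
              IsEffectiveCartier (I.comap σ) :=
  fun h U _ _ hreg hexc hdim I hI =>
    formatPrincipalization_dim3_of_cossartPiltant h U hreg hexc hdim I hI

end Summit.ResolutionOfSingularities.ResolutionOfSingularities.Theorems

end
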